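import Literature.Barriers.CriticalPhenomena.LaceExpansionGaussianLemma
import Mathlib.Analysis.SpecialFunctions.ImproperIntegrals
import Mathlib.MeasureTheory.Integral.Prod
import HarnessLib

/-!
# The integral representation `C(x) = ∫₀^∞ I_t(x) dt` of Hara's Gaussian lemma (Hara 2008, §2.1)

Barrier catalogue `Literature/Barriers/CriticalPhenomena/` (D-0021), on the way to discharging the
named fact `Hara2008_thm13` (`LaceExpansionGaussianLemma.lean`: Hara 2008, Thm. 1.3), to which
`Hara2008_etaZeroXSpace` (Heydenreich–van der Hofstad 2017, Thm. 11.4) has been reduced. Hara's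
proof of Thm. 1.3 (§2.1) starts from "an integral representation for `C(x)`, which was also used in
[HHS03]. The integrability of `{1 - Ĵ(k)}⁻¹` by (1.18), and a trivial identity
`1/A = ∫₀^∞ dt e^{-tA}` (`A > 0`) immediately imply
`C(x) = ∫ (d^dk/(2π)^d) e^{ik·x}/(1 - Ĵ(k)) = ∫ (d^dk/(2π)^d) e^{ik·x} ∫₀^∞ dt e^{-t{1-Ĵ(k)}}
= ∫₀^∞ dt I_t(x)` (2.1), with `I_t(x) := ∫ (d^dk/(2π)^d) e^{ik·x} e^{-t{1-Ĵ(k)}}` (2.2)."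
This file defines `haraI J t x = I_t(x)` and PROVES (2.1) (`haraC_eq_integral_haraI`) together
with the integrability of `t ↦ I_t(x)` on `(0, ∞)`, for `d ≥ 3` and an even absolutely summable
kernel obeying the infrared bound: Fubini on `[-π,π]^d × (0,∞)` (the absolute double integral is
`∫ dk/(1 - Ĵ(k))`, finite by `integrableOn_inv_one_sub_latticeFT`), the inner `t`-integral being
`∫₀^∞ e^{-t(1-Ĵ(k))} dt = 1/(1 - Ĵ(k))` for `k ≠ 0` (`1 - Ĵ(k) > 0` there, since `Ĵ` is real for
even `J`).

## References

* T. Hara, Ann. Probab. 36 (2008) 530–593 (arXiv:math-ph/0504021): §2.1, (2.1)–(2.2).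
-/

noncomputable section

namespace Literature.Barriers.CriticalPhenomena

open MeasureTheory Filter Finset Literature.Probability.LatticeModels Literature.Probability.Percolation
open scoped Topology BigOperators

variable {d : ℕ}

/-! ### Hara's `I_t(x)` -/

/-- Hara's `I_t(x) := ∫_{[-π,π]^d} (d^dk/(2π)^d) e^{ik·x} e^{-t{1 - Ĵ(k)}}` — the "heat kernel" at
time `t` of the (signed) generator `J - δ₀`, a Bochner integral over the cube.
[cite: Hara2008, §2.1 (2.2)] -/
def haraI (J : Site d → ℝ) (t : ℝ) (x : Site d) : ℂ :=
  (∫ k in cube d, Complex.exp (Complex.I * (kdot k x : ℂ)) *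
      Complex.exp (-(t : ℂ) * (1 - latticeFT J k))) / ((2 * Real.pi : ℂ) ^ d)

/-- `(2π)^d ≠ 0` in `ℂ`. [folklore] -/
theorem two_pi_pow_ne_zero (d : ℕ) : ((2 * Real.pi : ℂ) ^ d) ≠ 0 :=
  pow_ne_zero _ (by
    rw [show (2 * Real.pi : ℂ) = ((2 * Real.pi : ℝ) : ℂ) by push_cast; ring, Complex.ofReal_ne_zero]
    positivity)

/-- `∫₀^∞ e^{-tw} dt = 1/w` for `w > 0` (real). [folklore] -/
theorem integral_exp_neg_mul_Ioi {w : ℝ} (hw : 0 < w) :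
    ∫ t in Set.Ioi (0 : ℝ), Real.exp (-(t * w)) = w⁻¹ := by
  have h := integral_comp_mul_left_Ioi (fun s => Real.exp (-s)) 0 hw
  simp only [mul_zero] at h
  rw [integral_exp_neg_Ioi 0, neg_zero, Real.exp_zero, smul_eq_mul, mul_one] at h
  rw [← h]
  refine integral_congr_ae (Filter.Eventually.of_forall fun t => ?_)
  simp [mul_comm]

/-- **The integral representation `C(x) = ∫₀^∞ I_t(x) dt`** ("the integrability of
`{1 - Ĵ(k)}⁻¹` by (1.18), and a trivial identity `1/A = ∫₀^∞ dt e^{-tA}` (`A > 0`) immediately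
imply (2.1)"): for `d ≥ 3`, an even absolutely summable kernel with the infrared bound
`1 - Re Ĵ(k) ≥ K₀|k|²/(2d)` on `[-π,π]^d` (`K₀ > 0`), the function `t ↦ I_t(x)` is integrable on
`(0, ∞)` and `C(x) = ∫₀^∞ I_t(x) dt` (Fubini on `[-π,π]^d × (0,∞)`, the absolute integral being
`∫ dk/(1 - Ĵ(k)) < ∞`). [cite: Hara2008, §2.1 (2.1)–(2.2)] -/
theorem haraC_eq_integral_haraI (hd : 3 ≤ d) {J : Site d → ℝ} (hJ : Summable fun x => |J x|)
    (hJe : ∀ x, J (-x) = J x) {K₀ : ℝ} (hK₀ : 0 < K₀)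
    (hlow : ∀ k ∈ cube d, K₀ * (∑ i, k i ^ 2) / (2 * d) ≤ 1 - (latticeFT J k).re) (x : Site d) :
    IntegrableOn (fun t => haraI J t x) (Set.Ioi 0) ∧
      haraC J x = ∫ t in Set.Ioi (0 : ℝ), haraI J t x := by
  set μ : Measure (Fin d → ℝ) := volume.restrict (cube d) with hμ
  set ν : Measure ℝ := volume.restrict (Set.Ioi (0 : ℝ)) with hν
  set ω : (Fin d → ℝ) → ℂ := fun k => 1 - latticeFT J k with hω
  set w : (Fin d → ℝ) → ℝ := fun k => 1 - (latticeFT J k).re with hw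
  have hωw : ∀ k, ω k = (w k : ℂ) := fun k => one_sub_latticeFT_eq_ofReal hJ hJe k
  set F : (Fin d → ℝ) × ℝ → ℂ := fun p =>
    Complex.exp (Complex.I * (kdot p.1 x : ℂ)) * Complex.exp (-(p.2 : ℂ) * ω p.1) with hF
  -- continuity and measurability
  have hω_cont : Continuous ω := continuous_const.sub (continuous_latticeFT hJ)
  have hF_cont : Continuous F := by
    refine ((continuous_cexp_I_mul_kdot x).comp continuous_fst).mul (Complex.continuous_exp.comp ?_)
    exact ((Complex.continuous_ofReal.comp continuous_snd).neg).mul (hω_cont.comp continuous_fst)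
  have hF_meas : AEStronglyMeasurable F (μ.prod ν) := hF_cont.aestronglyMeasurable
  -- `w > 0` off `k = 0` on the cube (almost everywhere for `μ`)
  haveI : Nonempty (Fin d) := ⟨⟨0, by omega⟩⟩
  have hd0 : (0 : ℝ) < d := by exact_mod_cast (show 0 < d by omega)
  have hcube : MeasurableSet (cube d) := measurableSet_cube d
  have hw_pos : ∀ᵐ k ∂μ, 0 < w k := by
    have h_ne : ∀ᵐ k ∂μ, k ≠ (0 : Fin d → ℝ) := by
      have h0 : μ {(0 : Fin d → ℝ)} = 0 := by
        rw [hμ, Measure.restrict_apply (measurableSet_singleton 0)]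
        exact measure_mono_null Set.inter_subset_left (measure_singleton 0)
      filter_upwards [measure_eq_zero_iff_ae_notMem.1 h0] with k hk
      simpa using hk
    filter_upwards [ae_restrict_mem hcube, h_ne] with k hk hk0
    have hpos : 0 < ∑ i, k i ^ 2 := by
      obtain ⟨i, hi⟩ : ∃ i, k i ≠ 0 := by
        by_contra h
        push Not at h
        exact hk0 (funext h)
      exact lt_of_lt_of_le (by positivity)
        (Finset.single_le_sum (fun j _ => sq_nonneg (k j)) (Finset.mem_univ i))
    exact lt_of_lt_of_le (by positivity) (hlow k hk)
  -- the `t`-integrals for fixed `k` with `w k > 0`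
  have hexp_eq : ∀ (k : Fin d → ℝ) (t : ℝ), Complex.exp (-(t : ℂ) * ω k) = Complex.exp ((-ω k) * (t : ℂ)) :=
    fun k t => by ring_nf
  have hFk_int : ∀ k, 0 < w k → Integrable (fun t => F (k, t)) ν := by
    intro k hk
    have hre : (-ω k).re < 0 := by rw [hωw]; simpa using hk
    have h := (integrableOn_exp_mul_complex_Ioi hre 0).const_mul (Complex.exp (Complex.I * (kdot k x : ℂ)))
    refine h.congr (Filter.Eventually.of_forall fun t => ?_)
    simp only [hF, hexp_eq]
  have hFk_val : ∀ k, 0 < w k → ∫ t, F (k, t) ∂ν = Complex.exp (Complex.I * (kdot k x : ℂ)) * (ω k)⁻¹ := by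
    intro k hk
    have hre : (-ω k).re < 0 := by rw [hωw]; simpa using hk
    have hωne : ω k ≠ 0 := by rw [hωw]; exact_mod_cast hk.ne'
    simp only [hF, hexp_eq]
    rw [integral_const_mul]
    congr 1
    rw [hν, integral_exp_mul_complex_Ioi hre 0]
    simp only [Complex.ofReal_zero, mul_zero, Complex.exp_zero]
    field_simp
  have hFk_norm : ∀ k, 0 < w k → ∫ t, ‖F (k, t)‖ ∂ν = (w k)⁻¹ := by
    intro k hk
    have hnorm : ∀ t : ℝ, ‖F (k, t)‖ = Real.exp (-(t * w k)) := by
      intro t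
      simp only [hF]
      rw [norm_mul, norm_cexp_I_mul_kdot, one_mul, Complex.norm_exp, hωw]
      congr 1
      simp [Complex.mul_re]
    simp_rw [hnorm]
    exact integral_exp_neg_mul_Ioi hk
  -- integrability on the product
  have hinv : IntegrableOn (fun k => (ω k)⁻¹) (cube d) :=
    integrableOn_inv_one_sub_latticeFT hd hJ hJe hK₀ hlow
  have hInt : Integrable F (μ.prod ν) := by
    rw [integrable_prod_iff hF_meas]
    constructor
    · filter_upwards [hw_pos] with k hk using hFk_int k hk
    · have h1 : Integrable (fun k => ‖(ω k)⁻¹‖) μ := hinv.norm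
      refine h1.congr ?_
      filter_upwards [hw_pos] with k hk
      rw [hFk_norm k hk, hωw, ← Complex.ofReal_inv, Complex.norm_real, Real.norm_eq_abs,
        abs_of_pos (inv_pos.2 hk)]
  refine ⟨?_, ?_⟩
  · -- integrability of `t ↦ I_t(x)`
    have h := hInt.integral_prod_right
    refine (h.div_const ((2 * Real.pi : ℂ) ^ d)).congr (Filter.Eventually.of_forall fun t => ?_)
    simp only [haraI, hF, hμ, hω]
  · -- the representation
    have hC : haraC J x = (∫ k, ∫ t, F (k, t) ∂ν ∂μ) / ((2 * Real.pi : ℂ) ^ d) := by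
      unfold haraC
      congr 1
      refine integral_congr_ae ?_
      filter_upwards [hw_pos] with k hk
      rw [hFk_val k hk, div_eq_mul_inv]
    rw [hC, integral_integral_swap hInt, ← integral_div]
    refine integral_congr_ae (Filter.Eventually.of_forall fun t => ?_)
    simp only [haraI, hF, hμ, hω]

end Literature.Barriers.CriticalPhenomena
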